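import Mathlib
import Summits.Ventures.PercRepro2.Defs
import Summits.Ventures.PercRepro2.Independence
import Summits.Ventures.PercRepro2.Graph
import Summits.Ventures.PercRepro2.Events
import Summits.Ventures.PercRepro2.MM0Sector

/-!
# Row 2′MM0: the parallel rule — merging two parallel edges leaves (MM0⁻) unchanged
(blind cell PercRepro2, night-1 g4; `proofs/NIGHT1-G4.md` §3)

The third rule of the MARKED-SKELETON reduction (leaf: `MM0Prune`; series: `MM0SeriesMap` /
`MM0Series`). Two edges `e₁ ≠ e₂` with the same end pair are merged: `e₂` is re-pointed to a loop
(`parallelEnds`), and `e₁` carries the weight `1 − (1 − p e₁)(1 − p e₂)` of «at least one open».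

* `parallelMap e₁ e₂ ω := ω[e₁ ↦ ω e₁ ∨ ω e₂]`; `expect_parallelMap`: for `f` not depending on `e₂`,
  `E_p[f ∘ parallelMap] = E_{p[e₁ ↦ 1 − (1 − p e₁)(1 − p e₂)]}[f]`;
* `conn_parallel_iff`: connections in `(ends, ω)` are those of `(parallelEnds, parallelMap ω)`
  (a loop never connects, the merged edge is open iff one of the two was);
* `prob_parallel`, `connEvent_parallel`, `gate_parallel`, `Zev_parallel`;
* **`mm0minusForm_parallel`**: `mm0minusForm p ends = mm0minusForm p′ (parallelEnds …)`.
-/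

namespace Summit.Ventures.PercRepro2
namespace MM0Parallel

open MM0Sector

/-! ## The parallel map on configurations -/

section Map

variable {E : Type*} [DecidableEq E]

/-- The parallel map: the merged edge `e₁` is open iff `e₁` or `e₂` was. -/
def parallelMap (e₁ e₂ : E) (ω : Config E) : Config E := Function.update ω e₁ (ω e₁ || ω e₂)

/-- The parallel map changes nothing off `e₁`. -/
lemma parallelMap_apply_of_ne {e₁ e₂ e : E} (h : e ≠ e₁) (ω : Config E) :
    parallelMap e₁ e₂ ω e = ω e := by
  simp [parallelMap, Function.update_of_ne h]

/-- The parallel map at `e₁`. -/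
lemma parallelMap_apply_self (e₁ e₂ : E) (ω : Config E) :
    parallelMap e₁ e₂ ω e₁ = (ω e₁ || ω e₂) := by
  simp [parallelMap]

/-- The parallel map after forcing `e₁` open: `e₁` stays open. -/
lemma parallelMap_update_true {e₁ e₂ : E} (h12 : e₁ ≠ e₂) (ω : Config E) :
    parallelMap e₁ e₂ (Function.update ω e₁ true) = Function.update ω e₁ true := by
  simp [parallelMap, Function.update_of_ne h12.symm, Function.update_idem]

/-- The parallel map after forcing `e₁` closed: `e₁` takes the state of `e₂`. -/
lemma parallelMap_update_false {e₁ e₂ : E} (h12 : e₁ ≠ e₂) (ω : Config E) :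
    parallelMap e₁ e₂ (Function.update ω e₁ false) = Function.update ω e₁ (ω e₂) := by
  simp [parallelMap, Function.update_of_ne h12.symm, Function.update_idem]

end Map

/-! ## The expectation identity -/

section Expect

variable {E : Type*} [Fintype E] [DecidableEq E] {R : Type*} [CommRing R]

/-- **Parallel rule for expectations**: if `f` does not depend on `e₂`, the expectation of
`f ∘ parallelMap` under `p` is the expectation of `f` under `p[e₁ ↦ 1 − (1 − p e₁)(1 − p e₂)]`. -/
theorem expect_parallelMap (p : E → R) (f : Config E → R) {e₁ e₂ : E} (h12 : e₁ ≠ e₂)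
    (hf : ∀ ω b, f (Function.update ω e₂ b) = f ω) :
    expect p (fun ω => f (parallelMap e₁ e₂ ω)) =
      expect (Function.update p e₁ (1 - (1 - p e₁) * (1 - p e₂))) f := by
  have hR : expect (Function.update p e₁ (1 - (1 - p e₁) * (1 - p e₂))) f =
      (1 - (1 - p e₁) * (1 - p e₂)) * expect (Function.update p e₁ 1) f
        + (1 - (1 - (1 - p e₁) * (1 - p e₂))) * expect (Function.update p e₁ 0) f := by
    rw [expect_eq_pin (Function.update p e₁ (1 - (1 - p e₁) * (1 - p e₂))) f e₁]
    simp only [Function.update_self, Function.update_idem]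
  have hL1 : expect p (fun ω => f (parallelMap e₁ e₂ (Function.update ω e₁ true))) =
      expect (Function.update p e₁ 1) f := by
    rw [expect_update_one]
    refine congrArg _ (funext fun ω => ?_)
    rw [parallelMap_update_true h12]
  have hg1 : ∀ ω, f (parallelMap e₁ e₂ (Function.update (Function.update ω e₂ true) e₁ false)) =
      f (Function.update ω e₁ true) := by
    intro ω
    rw [parallelMap_update_false h12]
    simp only [Function.update_self]
    rw [Function.update_comm h12.symm, hf]
  have hg0 : ∀ ω, f (parallelMap e₁ e₂ (Function.update (Function.update ω e₂ false) e₁ false)) =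
      f (Function.update ω e₁ false) := by
    intro ω
    rw [parallelMap_update_false h12]
    simp only [Function.update_self]
    rw [Function.update_comm h12.symm, hf]
  have hL0 : expect p (fun ω => f (parallelMap e₁ e₂ (Function.update ω e₁ false))) =
      p e₂ * expect (Function.update p e₁ 1) f + (1 - p e₂) * expect (Function.update p e₁ 0) f := by
    rw [expect_eq_pin p _ e₂, expect_update_one, expect_update_zero]
    simp only [hg1, hg0]
    rw [← expect_update_one, ← expect_update_zero]
  rw [expect_eq_pin p _ e₁, expect_update_one, expect_update_zero, hL1, hL0, hR]
  ring

end Expect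

/-! ## The reduced graph and its connections -/

section Graph

variable {V : Type*} {E : Type*} [DecidableEq E]

/-- The reduced graph: `e₂` re-pointed to the loop `s(y, y)` (`e₁` keeps the common end pair). -/
def parallelEnds (ends : E → Sym2 V) (e₂ : E) (y : V) : E → Sym2 V :=
  Function.update ends e₂ s(y, y)

/-- A loop edge never contributes to a connection (the state of a loop edge is irrelevant). -/
lemma conn_update_loop_iff {ends' : E → Sym2 V} {e : E} {y : V} (hl : ends' e = s(y, y))
    (ω : Config E) (b : Bool) {m₁ m₂ : V} :
    Conn ends' (Function.update ω e b) m₁ m₂ ↔ Conn ends' ω m₁ m₂ := by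
  have key : ∀ (ω₁ ω₂ : Config E), (∀ e', e' ≠ e → ω₁ e' = ω₂ e') →
      Conn ends' ω₁ m₁ m₂ → Conn ends' ω₂ m₁ m₂ := by
    intro ω₁ ω₂ hω h
    let S : Set V := {z | Conn ends' ω₂ m₁ z}
    have hS : ∀ z ∈ S, ∀ z', (openGraph ends' ω₁).Adj z z' → z' ∈ S := by
      intro z hz z' hzz'
      obtain ⟨hne, e', he', hends⟩ := openGraph_adj.1 hzz'
      by_cases hee : e' = e
      · subst hee
        rw [hl, Sym2.eq_iff] at hends
        rcases hends with ⟨h1, h2⟩ | ⟨h1, h2⟩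
        · exact absurd (h1.symm.trans h2) hne
        · exact absurd (h2.symm.trans h1) hne
      · exact conn_trans hz (conn_of_openAdj ⟨e', by rw [← hω e' hee]; exact he', hends⟩)
    exact mem_of_conn_of_closed hS (conn_refl ends' ω₂ m₁) h
  constructor
  · exact key _ _ fun e' he' => Function.update_of_ne he' _ _
  · exact key _ _ fun e' he' => (Function.update_of_ne he' _ _).symm

variable {ends : E → Sym2 V} {e₁ e₂ : E} {y : V}

/-- **Parallel rule for connections**: if `e₁` and `e₂` have the same end pair, the connections of
`(ends, ω)` are those of the reduced graph with the parallel-mapped configuration. -/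
lemma conn_parallel_iff (hpar : ends e₁ = ends e₂) (h12 : e₁ ≠ e₂) (ω : Config E) (m₁ m₂ : V) :
    Conn (parallelEnds ends e₂ y) (parallelMap e₁ e₂ ω) m₁ m₂ ↔ Conn ends ω m₁ m₂ := by
  constructor
  · intro h
    let S : Set V := {z | Conn ends ω m₁ z}
    have hS : ∀ z ∈ S, ∀ z', (openGraph (parallelEnds ends e₂ y) (parallelMap e₁ e₂ ω)).Adj z z' →
        z' ∈ S := by
      intro z hz z' hzz'
      obtain ⟨hne, e, he, hends⟩ := openGraph_adj.1 hzz'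
      by_cases hee2 : e = e₂
      · rw [hee2] at hends
        simp only [parallelEnds, Function.update_self, Sym2.eq_iff] at hends
        rcases hends with ⟨h1, h2⟩ | ⟨h1, h2⟩
        · exact absurd (h1.symm.trans h2) hne
        · exact absurd (h2.symm.trans h1) hne
      rw [show parallelEnds ends e₂ y e = ends e from Function.update_of_ne hee2 _ _] at hends
      by_cases hee1 : e = e₁
      · rw [hee1, parallelMap_apply_self] at he
        rcases Bool.or_eq_true_iff.1 he with h1 | h2
        · exact conn_trans hz (conn_of_openAdj ⟨e₁, h1, hee1 ▸ hends⟩)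
        · exact conn_trans hz (conn_of_openAdj ⟨e₂, h2, by rw [← hpar, ← hee1]; exact hends⟩)
      · rw [parallelMap_apply_of_ne hee1] at he
        exact conn_trans hz (conn_of_openAdj ⟨e, he, hends⟩)
    exact mem_of_conn_of_closed hS (conn_refl ends ω m₁) h
  · intro h
    let S : Set V := {z | Conn (parallelEnds ends e₂ y) (parallelMap e₁ e₂ ω) m₁ z}
    have hS : ∀ z ∈ S, ∀ z', (openGraph ends ω).Adj z z' → z' ∈ S := by
      intro z hz z' hzz'
      obtain ⟨hne, e, he, hends⟩ := openGraph_adj.1 hzz'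
      by_cases hee2 : e = e₂
      · -- use the merged edge `e₁`, which is open since `e₂` is
        rw [hee2] at he hends
        refine conn_trans hz (conn_of_openAdj ⟨e₁, ?_, ?_⟩)
        · rw [parallelMap_apply_self, he, Bool.or_true]
        · rw [show parallelEnds ends e₂ y e₁ = ends e₁ from Function.update_of_ne h12 _ _, hpar]
          exact hends
      by_cases hee1 : e = e₁
      · rw [hee1] at he hends
        refine conn_trans hz (conn_of_openAdj ⟨e₁, ?_, ?_⟩)
        · rw [parallelMap_apply_self, he, Bool.true_or]
        · rw [show parallelEnds ends e₂ y e₁ = ends e₁ from Function.update_of_ne h12 _ _]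
          exact hends
      · refine conn_trans hz (conn_of_openAdj ⟨e, ?_, ?_⟩)
        · rw [parallelMap_apply_of_ne hee1]; exact he
        · rw [show parallelEnds ends e₂ y e = ends e from Function.update_of_ne hee2 _ _]; exact hends
    exact mem_of_conn_of_closed hS (conn_refl _ _ m₁) h

end Graph

/-! ## The parallel rule for the (MM0⁻) form -/

section Masses

variable {V : Type*} {E : Type*} [Fintype E] [DecidableEq E] [Fintype V] [DecidableEq V]
  {R : Type*} [CommRing R] [LinearOrder R] [IsStrictOrderedRing R]
  {ends : E → Sym2 V} {e₁ e₂ : E} {y : V}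

omit [Fintype V] [DecidableEq V] [LinearOrder R] [IsStrictOrderedRing R] in
/-- `P_p(parallelMap⁻¹ A′) = P_{p′}(A′)` for an event `A′` that does not depend on `e₂`. -/
lemma prob_parallel (p : E → R) (h12 : e₁ ≠ e₂) (A' : Set (Config E))
    (hA' : ∀ ω b, Function.update ω e₂ b ∈ A' ↔ ω ∈ A') :
    prob p (parallelMap e₁ e₂ ⁻¹' A') =
      prob (Function.update p e₁ (1 - (1 - p e₁) * (1 - p e₂))) A' := by
  rw [prob_eq_expect_indicator, prob_eq_expect_indicator]
  have hind : (parallelMap e₁ e₂ ⁻¹' A').indicator (1 : Config E → R) =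
      fun ω => A'.indicator 1 (parallelMap e₁ e₂ ω) := by
    funext ω
    by_cases h : parallelMap e₁ e₂ ω ∈ A'
    · rw [Set.indicator_of_mem (Set.mem_preimage.2 h), Set.indicator_of_mem h]
      rfl
    · rw [Set.indicator_of_notMem (fun h' => h (Set.mem_preimage.1 h')), Set.indicator_of_notMem h]
  rw [hind]
  refine expect_parallelMap p _ h12 (fun ω b => ?_)
  by_cases h : ω ∈ A'
  · rw [Set.indicator_of_mem h, Set.indicator_of_mem ((hA' ω b).2 h)]
    rfl
  · rw [Set.indicator_of_notMem h, Set.indicator_of_notMem (fun h' => h ((hA' ω b).1 h'))]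

variable (hpar : ends e₁ = ends e₂) (h12 : e₁ ≠ e₂)

include hpar h12 in
omit [Fintype E] [Fintype V] [DecidableEq V] in
/-- A connection event is the preimage of the reduced one. -/
lemma connEvent_parallel (m₁ m₂ : V) :
    connEvent ends m₁ m₂ = parallelMap e₁ e₂ ⁻¹' connEvent (parallelEnds ends e₂ y) m₁ m₂ := by
  ext ω
  simp only [connEvent, Set.mem_setOf_eq, Set.mem_preimage]
  exact (conn_parallel_iff hpar h12 ω m₁ m₂).symm

include hpar h12 in
omit [Fintype E] [Fintype V] [DecidableEq V] in
/-- The gate is the preimage of the reduced gate. -/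
lemma gate_parallel (s t u w : V) :
    gate ends s t u w = parallelMap e₁ e₂ ⁻¹' gate (parallelEnds ends e₂ y) s t u w := by
  simp only [gate, bridge, connEvent_parallel (y := y) hpar h12, Set.preimage_inter, Set.preimage_union,
    Set.preimage_compl]

include hpar h12 in
omit [Fintype E] [Fintype V] [DecidableEq V] in
/-- `Zev` is the preimage of the reduced `Zev`. -/
lemma Zev_parallel (t u w v : V) :
    Zev ends t u w v = parallelMap e₁ e₂ ⁻¹' Zev (parallelEnds ends e₂ y) t u w v := by
  simp only [Zev, connEvent_parallel (y := y) hpar h12, Set.preimage_inter, Set.preimage_union]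

omit [Fintype E] [Fintype V] [DecidableEq V] in
/-- A reduced connection event does not depend on the loop edge `e₂`. -/
lemma edgeIndep_connEvent_parallel (m₁ m₂ : V) : ∀ ω b,
    Function.update ω e₂ b ∈ connEvent (parallelEnds ends e₂ y) m₁ m₂ ↔
      ω ∈ connEvent (parallelEnds ends e₂ y) m₁ m₂ := fun ω b => by
  simp only [connEvent, Set.mem_setOf_eq]
  exact conn_update_loop_iff (show parallelEnds ends e₂ y e₂ = s(y, y) from Function.update_self _ _ _) ω b

omit [Fintype E] [Fintype V] [DecidableEq V] in
/-- The reduced gate does not depend on the loop edge `e₂`. -/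
lemma edgeIndep_gate_parallel (s t u w : V) : ∀ ω b,
    Function.update ω e₂ b ∈ gate (parallelEnds ends e₂ y) s t u w ↔
      ω ∈ gate (parallelEnds ends e₂ y) s t u w := fun ω b => by
  simp only [gate, bridge, Set.mem_inter_iff, Set.mem_compl_iff, Set.mem_union,
    edgeIndep_connEvent_parallel (ends := ends) (e₂ := e₂) (y := y) _ _ ω b]

omit [Fintype E] [Fintype V] [DecidableEq V] in
/-- The reduced `Zev` does not depend on the loop edge `e₂`. -/
lemma edgeIndep_Zev_parallel (t u w v : V) : ∀ ω b,
    Function.update ω e₂ b ∈ Zev (parallelEnds ends e₂ y) t u w v ↔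
      ω ∈ Zev (parallelEnds ends e₂ y) t u w v := fun ω b => by
  simp only [Zev, Set.mem_inter_iff, Set.mem_union,
    edgeIndep_connEvent_parallel (ends := ends) (e₂ := e₂) (y := y) _ _ ω b]

include hpar h12 in
omit [Fintype V] [DecidableEq V] [LinearOrder R] [IsStrictOrderedRing R] in
/-- **Parallel rule for (MM0⁻)**: merging two parallel edges (`e₂` re-pointed to a loop, `e₁` at the
weight `1 − (1 − p e₁)(1 − p e₂)`) leaves the cubic form of row 2′MM0 unchanged. -/
theorem mm0minusForm_parallel (p : E → R) (s t b u w v : V) :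
    mm0minusForm p ends s t b u w v =
      mm0minusForm (Function.update p e₁ (1 - (1 - p e₁) * (1 - p e₂))) (parallelEnds ends e₂ y)
        s t b u w v := by
  have hst := edgeIndep_connEvent_parallel (ends := ends) (e₂ := e₂) (y := y) s t
  have hsb := edgeIndep_connEvent_parallel (ends := ends) (e₂ := e₂) (y := y) s b
  have htv := edgeIndep_connEvent_parallel (ends := ends) (e₂ := e₂) (y := y) t v
  have hg := edgeIndep_gate_parallel (ends := ends) (e₂ := e₂) (y := y) s t u w
  have hz := edgeIndep_Zev_parallel (ends := ends) (e₂ := e₂) (y := y) t u w v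
  have hc : ∀ {A B : Set (Config E)}, (∀ ω b, Function.update ω e₂ b ∈ A ↔ ω ∈ A) →
      (∀ ω b, Function.update ω e₂ b ∈ B ↔ ω ∈ B) →
      ∀ ω b, Function.update ω e₂ b ∈ A ∩ B ↔ ω ∈ A ∩ B := fun hA hB ω b => by
    simp only [Set.mem_inter_iff, hA ω b, hB ω b]
  have hcc : ∀ {A : Set (Config E)}, (∀ ω b, Function.update ω e₂ b ∈ A ↔ ω ∈ A) →
      ∀ ω b, Function.update ω e₂ b ∈ Aᶜ ↔ ω ∈ Aᶜ := fun hA ω b => by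
    simp only [Set.mem_compl_iff, hA ω b]
  simp only [mm0minusForm, gate_parallel (y := y) hpar h12, Zev_parallel (y := y) hpar h12,
    connEvent_parallel (y := y) hpar h12, ← Set.preimage_compl, ← Set.preimage_inter]
  rw [prob_parallel p h12 _ (hcc hst), prob_parallel p h12 _ (hc (hc hsb hz) hg),
    prob_parallel p h12 _ (hc hsb (hcc hst)), prob_parallel p h12 _ (hc hz hg),
    prob_parallel p h12 _ (hc htv (hcc hst)), prob_parallel p h12 _ (hc hsb hg),
    prob_parallel p h12 _ hg]

end Masses

end MM0Parallel
end Summit.Ventures.PercRepro2
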